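import Summits.RiemannHypothesis.RiemannHypothesis.Theorems.WeilColumnYoungMoll
import HarnessLib

/-!
# `(f ⋆ φ_k)′ = f′ ⋆ φ_k` for `C¹` compactly supported `f`, and `∫‖(f ⋆ φ_k)′‖² ≤ ∫‖f′‖²` (RH-FREE; PR Step 5 of THETA-ASSIGN §6)

Cell `rh-explicit`, WEIL column, seat handoff-prove-2 gen12.  For `f : ℝ → ℂ` of class `C¹` (`ContDiff ℝ 1 f`; e.g. from
`contDiff_one_iff_deriv`: differentiable with continuous derivative) with compact support:

* `deriv_weilConv_moll : deriv (weilConv f (moll k)) = weilConv (deriv f) (moll k)` (Mathlib `HasCompactSupport.hasDerivAt_convolution_left`);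
* **`integral_norm_sq_deriv_weilConv_moll_le : ∫‖deriv (weilConv f (moll k)) x‖² ≤ ∫‖deriv f x‖²`** (Young in `L²`, `WeilColumnYoungMoll`).
With `integral_norm_sq_weilConv_moll_le` this feeds `ThetaParams.re_weilArchTerm_le_arch` (`WeilColumnThetaArchBound`) for the mollified
truncated tails: the D7 bound `≤ P.arch t₀` holds at every mollification level `k`.  Nothing here bears on the truth of RH.
-/

noncomputable section

set_option linter.dupNamespace false

open Complex Set MeasureTheory Filter Function
open scoped Real Topology

namespace Summit.RiemannHypothesis.RiemannHypothesis.Theorems.WeilColumn.ThetaMellin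

open Literature.NumberTheory.LFunctions Literature.NumberTheory.LFunctions.WeilContinuous

variable {f : ℝ → ℂ}

/-- `(f ⋆ φ_k)′ = f′ ⋆ φ_k` for `f ∈ C¹` with compact support. [folklore] -/
theorem deriv_weilConv_moll (hf : ContDiff ℝ 1 f) (hfs : HasCompactSupport f) (k : ℕ) :
    deriv (weilConv f (moll k)) = weilConv (deriv f) (moll k) := by
  funext t
  rw [weilConv_eq_convolution_real, weilConv_eq_convolution_real]
  exact (hfs.hasDerivAt_convolution_left (ContinuousLinearMap.mul ℝ ℂ) hf
    (continuous_moll k).locallyIntegrable t).deriv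

/-- `f′` is continuous with compact support for `f ∈ C¹` compactly supported. -/
theorem continuous_deriv_of_contDiff_one (hf : ContDiff ℝ 1 f) : Continuous (deriv f) :=
  (contDiff_one_iff_deriv.1 hf).2

/-- **`∫‖(f ⋆ φ_k)′‖² ≤ ∫‖f′‖²`** for `f ∈ C¹` with compact support. [folklore: Young] -/
theorem integral_norm_sq_deriv_weilConv_moll_le (hf : ContDiff ℝ 1 f) (hfs : HasCompactSupport f) (k : ℕ) :
    ∫ x, ‖deriv (weilConv f (moll k)) x‖ ^ 2 ≤ ∫ x, ‖deriv f x‖ ^ 2 := by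
  rw [deriv_weilConv_moll hf hfs k]
  exact integral_norm_sq_weilConv_moll_le (continuous_deriv_of_contDiff_one hf) hfs.deriv k

end Summit.RiemannHypothesis.RiemannHypothesis.Theorems.WeilColumn.ThetaMellin

end
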